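import Literature.AlgebraicGeometry.Modules.LocallyFreeTraceCyclic
import Literature.AlgebraicGeometry.Modules.RankOneCocycle
import Literature.AlgebraicGeometry.Modules.DetClassOfIso
import Literature.AlgebraicGeometry.Modules.FrameTransition
import Literature.AlgebraicGeometry.Modules.LinearOverBase
import Literature.AlgebraicGeometry.Morphisms.GlobalSectionsProperWithSection
import Literature.AlgebraicGeometry.Modules.PullbackClosedImmersionCokernel
import HarnessLib

/-!
# Endomorphisms of a locally free `𝒪_X`-module of rank one are global functions

Layer `Literature/AlgebraicGeometry/Modules`, namespace `Literature.AlgebraicGeometry.Modules`. THEOREMS ONLY (no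
definition, no named fact, no instance, no notation). Cell `hodgecm-mathlib` (D-0151), M1PRIME-DAG rung 0, J0a junction
(B-p07 lineage, leaf (J0a-2)(b) «rigidity of isomorphisms of line bundles»): the descent datum of Mumford's bundle
`Λ(𝒪(Θ))` along `1 × φ_Θ` (Mumford, *Abelian Varieties* §8; the tree's `Modules/EquivariantStructure` consumed by
`RelativeSpec/EquivariantModuleDescent`) is pinned down by normalisation once one knows that an isomorphism of line bundles
on a complete variety is unique up to a non-zero scalar. Banked capital; HC_CM is proved only modulo the 7 printed
citations until rung 0 closes.

For a scheme `X` and an `𝒪_X`-module `E` locally free of rank one (`Motives.IsFiniteLocallyFree E`, `Motives.HasRank E 1`):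

* `eq_overScalar_trace_of_unique` — below a rank-one frame `e : 𝒪 ≅ E|_W` every `φ : E|_W → E|_W` is multiplication by
  its trace `tr(φ) ∈ Γ(X, W)` (`Modules/LocallyFreeTrace.trace`);
* **`eq_globalScalar_trace`** — every endomorphism `f : E ⟶ E` is multiplication by the global function
  `tr(f) ∈ Γ(X, 𝒪_X)` (`Modules/LinearOverBase.globalScalar`): `𝓔nd(E) = E^∨ ⊗ E = 𝒪_X` for a line bundle
  ([Hartshorne1977] II Ex. 5.1 (b)–(d)), read on global sections;
* `eq_of_globalScalar_eq` — `a ↦ a · 𝟙_E` is injective for `E` locally free of positive rank, so the function is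
  unique (`exists_unique_eq_globalScalar`);
* **`exists_unique_eq_smul_id`** — over a ring `K`, if `K → Γ(X, 𝒪_X)` is bijective (e.g. `K` a field and `X`
  proper and integral with a `K`-point, ★ `Morphisms.bijective_algebraMapΓ_of_universallyClosed_of_section`,
  [Hartshorne1977] I Thm. 3.4 (a) / II Ex. 4.5 (d)), every endomorphism of `E` is `c • 𝟙_E` for a unique `c : K`, and
  two isomorphisms `E ≅ E'` differ by a unique non-zero scalar (`exists_unique_iso_hom_eq_smul`, `isUnit_of_iso_hom_eq_smul`);
* `pullback_map_base_smul` — pull-back along a `K`-morphism is `K`-linear (over ★ `Modules/PullbackClosedImmersionCokernel.pullback_map_globalScalar`).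

## References

* [Hartshorne1977] R. Hartshorne, *Algebraic Geometry*, GTM 52 (1977): II Ex. 5.1 (b)–(d) (p. 123) (`𝓗om`, `E^∨ ⊗ E`,
  trace for locally free sheaves), I Thm. 3.4 (a) (p. 18) (regular functions on a projective variety are constant),
  II Ex. 4.5 (d).
* [MumfordAV1970] D. Mumford, *Abelian Varieties* (1970), §8 pp. 78–80 (normalised isomorphisms of `Λ(L)`; the use made
  of this file downstream).
-/

noncomputable section

open CategoryTheory AlgebraicGeometry Opposite TopologicalSpace

universe u

namespace Literature.AlgebraicGeometry.Modules

open Literature.AlgebraicGeometry.Motives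

variable {X : Scheme.{u}} {E E' : X.Modules}

/-! ### §1 Below a rank-one frame: `φ = tr(φ) · id` -/

/-- **Below a rank-one frame every endomorphism is multiplication by its trace**: for a trivialisation
`e : 𝒪^I ≅ E|_W` with `I` a one-element type and `φ : E|_W → E|_W`, `φ = tr(φ) · 𝟙` where `tr(φ) = λ(φ(b))`
(`b` the basis section, `λ` the dual basis section). [cite: Hartshorne1977, II Ex. 5.1 (b) (p. 123)] -/
theorem eq_overScalar_trace_of_unique (hE : IsFiniteLocallyFree E) {W : X.Opens} {I : Type u} [Unique I]
    (e : SheafOfModules.free I ≅ E.over W) (φ : E.over W ⟶ E.over W) :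
    φ = overScalar E W ((trace hE).app W φ) := by
  refine hom_ext_of_basisSection e fun i => ?_
  obtain rfl : i = default := Unique.eq_default i
  rw [appLE_overScalar, structurePresheaf_map_id, trace_app_eq_sum hE e, Fintype.sum_unique]
  conv_lhs => rw [eq_sum_coord_smul e (𝟙 W) (appLE φ (𝟙 W) (basisSection e default)), Fintype.sum_unique]
  rw [coord_def, op_id, E.presheaf.map_id]
  rfl

/-! ### §2 Globally: `f = tr(f) · 𝟙_E` -/

/-- **An endomorphism of a locally free module of rank one is multiplication by a global function**, namely by its
trace `tr(f) ∈ Γ(X, 𝒪_X)`: `f = tr(f) · 𝟙_E` (`𝓔nd(E) ≅ 𝒪_X` for a line bundle, on global sections). The trace is taken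
of `f` viewed as a section of `𝓗om(E, E)` over `X` (`(SheafOfModules.overFunctor _ ⊤).map f`).
[cite: Hartshorne1977, II Ex. 5.1 (b)–(d) (p. 123)] -/
theorem eq_globalScalar_trace (hE : IsFiniteLocallyFree E) (h₁ : HasRank E 1) (f : E ⟶ E) :
    f = globalScalar E ((trace hE).app ⊤ ((SheafOfModules.overFunctor _ ⊤).map f)) := by
  obtain ⟨F, hF⟩ := exists_frameSystem_of_hasRank h₁
  set a : Γ(X, ⊤) := (trace hE).app ⊤ ((SheafOfModules.overFunctor _ ⊤).map f) with ha
  refine Scheme.Modules.hom_ext _ _ fun V => ?_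
  ext s
  -- equality of sections of `E` over `V` is local on the cover `V ⊓ U_x`
  refine TopCat.Sheaf.eq_of_locally_eq' (C := AddCommGrpCat.{u}) ⟨E.presheaf, E.isSheaf⟩
    (fun x : V => V ⊓ F.U x.1) V (fun x => homOfLE inf_le_left)
    (fun x hx => Opens.mem_iSup.mpr ⟨⟨x, hx⟩, hx, F.mem x⟩) _ _ fun ⟨x, hx⟩ => ?_
  haveI : Unique (F.I x) := ((F.enum x).trans (finCongr (hF x))).unique
  -- the rank-one frame on `W := V ⊓ U_x`
  let e := SheafOfModules.restrictTrivialisation (R := X.ringCatSheaf)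
    (homOfLE (inf_le_right : V ⊓ F.U x ≤ F.U x)) (F.frame x)
  have key := eq_overScalar_trace_of_unique hE e ((SheafOfModules.overFunctor _ (V ⊓ F.U x)).map f)
  -- `tr(f|_W) = tr(f)|_W`
  have htr : (trace hE).app (V ⊓ F.U x) ((SheafOfModules.overFunctor _ (V ⊓ F.U x)).map f) =
      X.presheaf.map (homOfLE (le_top : V ⊓ F.U x ≤ ⊤)).op a := by
    rw [ha, map_trace_app hE (homOfLE le_top), restrictHom_over_map]
  change E.presheaf.map (homOfLE (inf_le_left : V ⊓ F.U x ≤ V)).op (f.app V s) =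
    E.presheaf.map (homOfLE (inf_le_left : V ⊓ F.U x ≤ V)).op ((globalScalar E a).app V s)
  rw [← Scheme.Modules.Hom.app_map_apply, ← Scheme.Modules.Hom.app_map_apply, globalScalar_app_apply,
    ← appLE_over_map f (𝟙 (V ⊓ F.U x)), key, appLE_overScalar, structurePresheaf_map_id, htr]

/-- **`a ↦ a · 𝟙_E` is injective for a locally free module of positive rank**: if `a · s = b · s` for all sections then
`a = b` (test on a local basis section). [cite: Hartshorne1977, II.5 (p. 109)] -/
theorem eq_of_globalScalar_eq {r : ℕ} (hr : 0 < r) (h : HasRank E r) {a b : Γ(X, ⊤)}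
    (hab : globalScalar E a = globalScalar E b) : a = b := by
  obtain ⟨F, hF⟩ := exists_frameSystem_of_hasRank h
  refine TopCat.Sheaf.eq_of_locally_eq' (X.sheaf : TopCat.Sheaf CommRingCat X) F.U ⊤
    (fun x => homOfLE le_top) (fun x _ => Opens.mem_iSup.mpr ⟨x, F.mem x⟩) a b fun x => ?_
  change X.presheaf.map (homOfLE (le_top : F.U x ≤ ⊤)).op a = X.presheaf.map (homOfLE (le_top : F.U x ≤ ⊤)).op b
  -- test on the basis section `b_x` of index `0`
  let i : F.I x := (F.enum x).symm ⟨0, by rw [hF x]; exact hr⟩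
  have hs := congrArg
    (fun φ : E ⟶ E => coord (F.frame x) (𝟙 (F.U x)) (φ.app (F.U x) (basisSection (F.frame x) i)) i) hab
  simp only [globalScalar_app_apply] at hs
  rwa [coord_smul, coord_smul, coord_basisSection, if_pos rfl, mul_one, mul_one] at hs

/-- The global function of `eq_globalScalar_trace` is unique. [cite: Hartshorne1977, II Ex. 5.1 (b) (p. 123)] -/
theorem exists_unique_eq_globalScalar (h₁ : HasRank E 1) (f : E ⟶ E) :
    ∃! a : Γ(X, ⊤), f = globalScalar E a := by
  refine ⟨_, eq_globalScalar_trace (HasRank.isFiniteLocallyFree' h₁) h₁ f, fun b hb => ?_⟩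
  exact eq_of_globalScalar_eq Nat.one_pos h₁
    (hb.symm.trans (eq_globalScalar_trace (HasRank.isFiniteLocallyFree' h₁) h₁ f))

/-! ### §3 Over a field with `Γ(X, 𝒪_X) = K`: endomorphisms are scalars, isomorphisms are unique up to a scalar -/

section OverField

variable {K : Type u} [CommRing K] {Y : Over (Spec (CommRingCat.of K))} {M M' : Y.left.Modules}

/-- `c • 𝟙_M` is multiplication by the global function `c · 1 ∈ Γ(X, 𝒪_X)`. [cite: GortzWedhorn2020, §(7.3), (7.3.6)] -/
theorem base_smul_id_eq_globalScalar (c : K) : c • 𝟙 M = globalScalar M (scalarRingHomTop Y c) := by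
  rw [base_smul_eq, Category.comp_id]

/-- **Endomorphisms of a line bundle on a `K`-scheme with `Γ(X, 𝒪_X) = K` are scalars**: if the structure map
`K → Γ(X, 𝒪_X)` is bijective (e.g. `X` proper and integral with a `K`-point — `K` a field —
★ `Morphisms.bijective_algebraMapΓ_of_universallyClosed_of_section`; [Hartshorne1977] I Thm. 3.4 (a)) and `M` is
locally free of rank one, every `f : M ⟶ M` is `c • 𝟙_M` for a unique `c : K`.
[cite: Hartshorne1977, I Thm. 3.4 (a) (p. 18) and II Ex. 5.1 (b) (p. 123)] -/
theorem exists_unique_eq_smul_id (hΓ : Function.Bijective (scalarRingHomTop Y)) (h₁ : HasRank M 1) (f : M ⟶ M) :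
    ∃! c : K, f = c • 𝟙 M := by
  obtain ⟨a, ha, -⟩ := exists_unique_eq_globalScalar h₁ f
  obtain ⟨c, rfl⟩ := hΓ.2 a
  refine ⟨c, ?_, fun c' hc' => hΓ.1 ?_⟩
  · change f = c • 𝟙 M
    rw [base_smul_id_eq_globalScalar]; exact ha
  · change f = c' • 𝟙 M at hc'
    refine eq_of_globalScalar_eq Nat.one_pos h₁ ?_
    rw [← base_smul_id_eq_globalScalar, ← base_smul_id_eq_globalScalar, ← hc', base_smul_id_eq_globalScalar]
    exact ha

/-- **Two isomorphisms of line bundles differ by a unique scalar**: for `φ ψ : M ≅ M'` with `M` locally free of rank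
one on a `K`-scheme with `Γ(X, 𝒪_X) = K`, `ψ = c • φ` for a unique `c : K` (apply the previous statement to
`ψ ≫ φ⁻¹`). This is the rigidity that pins down normalised isomorphisms of line bundles ([MumfordAV1970] §8).
[cite: Hartshorne1977, II Ex. 5.1 (b) (p. 123)] [cite: MumfordAV1970, §8 (pp. 78–80)] -/
theorem exists_unique_iso_hom_eq_smul (hΓ : Function.Bijective (scalarRingHomTop Y)) (h₁ : HasRank M 1)
    (φ ψ : M ≅ M') : ∃! c : K, ψ.hom = c • φ.hom := by
  obtain ⟨c, hc, huniq⟩ := exists_unique_eq_smul_id hΓ h₁ (ψ.hom ≫ φ.inv)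
  refine ⟨c, ?_, fun c' hc' => huniq c' ?_⟩
  · rw [← Category.comp_id ψ.hom, ← φ.inv_hom_id, ← Category.assoc, hc, Linear.smul_comp, Category.id_comp]
  · rw [hc', Linear.smul_comp, φ.hom_inv_id]

/-- The scalar of `exists_unique_iso_hom_eq_smul` is a unit when `K` is a field (and conversely every unit scalar
multiple of an isomorphism is an isomorphism, `CategoryTheory.Linear`). [cite: Hartshorne1977, II Ex. 5.1 (b) (p. 123)] -/
theorem isUnit_of_iso_hom_eq_smul {K : Type u} [Field K] {Y : Over (Spec (CommRingCat.of K))} {M M' : Y.left.Modules}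
    (hΓ : Function.Bijective (scalarRingHomTop Y)) (h₁ : HasRank M 1) (φ ψ : M ≅ M') {c : K}
    (hc : ψ.hom = c • φ.hom) : IsUnit c := by
  rcases eq_or_ne c 0 with rfl | hne
  · -- `ψ = 0`, so `𝟙_M = 0`, so `1 = 0` in `Γ(X, 𝒪_X) ≅ K`: impossible for a field
    exfalso
    rw [zero_smul] at hc
    have h1 : (𝟙 M : M ⟶ M) = 0 := by rw [← ψ.hom_inv_id, hc, Limits.zero_comp]
    have h := eq_of_globalScalar_eq Nat.one_pos h₁
      (show globalScalar M (scalarRingHomTop Y 1) = globalScalar M (scalarRingHomTop Y 0) by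
        rw [← base_smul_id_eq_globalScalar, ← base_smul_id_eq_globalScalar, one_smul, zero_smul, h1])
    exact one_ne_zero (hΓ.1 h)
  · exact isUnit_iff_ne_zero.mpr hne

end OverField

/-! ### §4 Pull-back of scalar endomorphisms -/

section Pullback

/-- Pull-back along a morphism of `K`-schemes is `K`-linear on morphisms of modules: `g^*(c • φ) = c • g^*φ`
(★ `pullback_map_globalScalar`: `g^*(a · 𝟙) = g♯(a) · 𝟙`, and `g♯` fixes the constants).
[cite: Hartshorne1977, II.5 (p. 110)] -/
theorem pullback_map_base_smul {K : Type u} [CommRing K] {Y Y' : Over (Spec (CommRingCat.of K))} (g : Y' ⟶ Y)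
    {M N : Y.left.Modules} (c : K) (φ : M ⟶ N) :
    (Scheme.Modules.pullback g.left).map (c • φ) = c • (Scheme.Modules.pullback g.left).map φ := by
  rw [base_smul_eq, base_smul_eq, Functor.map_comp, pullback_map_globalScalar]
  congr 2
  change (Y.hom.appTop ≫ g.left.appTop) ((Scheme.ΓSpecIso (CommRingCat.of K)).inv c) =
    Y'.hom.appTop ((Scheme.ΓSpecIso (CommRingCat.of K)).inv c)
  rw [← Scheme.Hom.comp_appTop, Over.w g]

end Pullback

end Literature.AlgebraicGeometry.Modules

end
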